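import Mathlib
import HarnessLib
import Summits.NavierStokesRegularity.NavierStokesRegularity.Theorems.PoloidalWindowDoorPoloidalWindowRigidityZoomOut

/-!
# Route `PoloidalWindowDoor`, crux `PoloidalWindowRigidity` (K2, stmt-NavierStokesRegularity-19708) —
# FORWARD ε-REGULARITY FROM ONE SLICE for the Type-I class, and its consequence:
# a nontrivial profile is UNIFORMLY NON-SMALL AT EVERY FAR-PAST TIME

Cell ns-regularity-ideate, K2 lead ns-poloidal-K2-p1 (gen 4; class-level tool, `--supports stmt-…-19708`).  Companion of
ns-poloidal-K2-p2's BACKWARD ε-regularity on a tail (`…ZoomOut.exists_eps_eq_zero_tail`).  For the whole route class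
`𝔓(C)` (Type-I rate, unit-viscosity Oseen-mild between negative times — no poloidality, no continuity needed):

* `exists_kappa_forward_small` — **FORWARD SMALLNESS FROM ONE SLICE.**  There is an absolute `κ > 0` such that: if at ONE
  time `t₀ < 0` the slice is small in scale-invariant size, `‖v(t₀, ·)‖ ≤ δ` with `√(−t₀) δ ≤ κ`, then `‖v(t, ·)‖ ≤ 2δ` for
  every `t ∈ (t₀, 0)`.  Proof (no continuity argument): a DISCRETE BOOTSTRAP on the time steps `t₀ + n h` — the crude
  bound `3δ` on the next step comes from the mild identity restarted half a step back inside the controlled region (the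
  Duhamel term is `O(A²√h)` with the a-priori Type-I bound `A` on the window), and the sharp bound `2δ` is then recovered
  from the mild identity started at `t₀` (`δ + 18 C_os δ²√(−t₀) ≤ 2δ`).
* `eq_zero_of_frequently_small` — hence a profile that is small at SOME time below every `T`
  (`∀ ε > 0 ∀ T ∃ t < T, sup_x √(−t)‖v(t,x)‖ ≤ ε`, i.e. `liminf_{t→−∞} sup_x √(−t)‖v(t,x)‖ = 0`) is small on the whole
  slab, hence trivial by the backward ε-regularity (`exists_eps_eq_zero_tail` with `T = 0`).
* `exists_uniformly_nonsmall` — contrapositive: a NONTRIVIAL profile of the class carries `ε > 0` and `T < 0` with a bad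
  point on EVERY slice `t < T`: `∃ x, ε < √(−t)‖v(t,x)‖`.  (So zoom-out arguments may place their bad points at ANY
  prescribed sequence of far-past times — e.g. where an auxiliary quantity such as the (TV) slope is extreme: the lead's
  `…TimeShearPast`.)

WHAT THIS IS NOT: not a claim about Navier–Stokes regularity — a class-level tool (bears_on LADDER-NS N0, rung
N0-LocalTubeDoorPoloidal).
-/

noncomputable section

-- the summit and its single sub-problem share the name (CONVENTIONS §1), as in every Theorems file
set_option linter.dupNamespace false

namespace Summit.NavierStokesRegularity.NavierStokesRegularity.Theorems.PoloidalWindowDoorPoloidalWindowRigidityForwardSmallness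

open MeasureTheory Set Function Filter Topology
open scoped RealInnerProductSpace InnerProductSpace
open Literature.Analysis Literature.Analysis.FluidPDE
open Summit.NavierStokesRegularity.NavierStokesRegularity.Theorems.PoloidalWindowDoorPoloidalWindowRigidityZoomOut

variable {C : ℝ} {v : ℝ → EuclideanSpace ℝ (Fin 3) → EuclideanSpace ℝ (Fin 3)}

/-! ### forward smallness from one slice -/

/-- **FORWARD ε-REGULARITY FROM ONE SLICE (scale-invariant `L^∞` form).**  There is an absolute `κ > 0` such that for
every profile with the Type-I rate and the Oseen identity between negative times: if `t₀ < 0`, `0 < δ`,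
`‖v(t₀, x)‖ ≤ δ` for all `x` and `√(−t₀) δ ≤ κ`, then `‖v(t, x)‖ ≤ 2δ` for all `t ∈ (t₀, 0)` and all `x`. -/
theorem exists_kappa_forward_small :
    ∃ κ : ℝ, 0 < κ ∧ ∀ {C : ℝ} {v : ℝ → EuclideanSpace ℝ (Fin 3) → EuclideanSpace ℝ (Fin 3)},
      HasTypeITimeDecay C v →
      (∀ s t : ℝ, s < t → t < 0 → ∀ x,
        v t x = UnboundedOperators.heatExtension (v s) (t - s) x - oseenDuhamel 1 s v v t x) →
      ∀ {t₀ δ : ℝ}, t₀ < 0 → 0 < δ → (∀ x, ‖v t₀ x‖ ≤ δ) → Real.sqrt (-t₀) * δ ≤ κ →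
        ∀ t ∈ Ioo t₀ 0, ∀ x, ‖v t x‖ ≤ 2 * δ := by
  obtain ⟨Cos, hCos, hDuh⟩ := exists_norm_oseenDuhamel_bounded_le (E := EuclideanSpace ℝ (Fin 3))
  refine ⟨1 / (18 * Cos), by positivity, ?_⟩
  intro C v hrate hmild t₀ δ ht₀ hδ hsmall hκ tstar htstar x
  have hone : (1 : ℝ) ^ (-(1 / 2 : ℝ)) = 1 := Real.one_rpow _
  -- `18 C_os δ √(−t₀) ≤ 1`
  have h18 : 18 * Cos * δ * Real.sqrt (-t₀) ≤ 1 := by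
    have h := mul_le_mul_of_nonneg_left hκ (by positivity : (0 : ℝ) ≤ 18 * Cos)
    rw [mul_one_div_cancel (by positivity : (18 : ℝ) * Cos ≠ 0)] at h
    linarith [h]
  -- the window `(t₀, t₁)`, `t₁ = t⋆/2`, and the a-priori bound `A` there
  set t₁ : ℝ := tstar / 2 with ht₁
  have ht₁0 : t₁ < 0 := by rw [ht₁]; linarith [htstar.2]
  have hst₁ : tstar < t₁ := by rw [ht₁]; linarith [htstar.2]
  have ht₀₁ : t₀ < t₁ := htstar.1.trans hst₁
  have hC0 : 0 ≤ C := by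
    have hs : 0 < Real.sqrt (-t₀) := Real.sqrt_pos.2 (neg_pos.2 ht₀)
    have h := (norm_nonneg (v t₀ 0)).trans (hrate t₀ ht₀ 0)
    rw [le_div_iff₀ hs, zero_mul] at h
    exact h
  set A : ℝ := C / Real.sqrt (-t₁) + δ with hA
  have hA0 : 0 ≤ A := by positivity
  have hAbd : ∀ σ < t₁, ∀ y, ‖v σ y‖ ≤ A := by
    intro σ hσ y
    have hσ0 : σ < 0 := hσ.trans ht₁0
    refine (hrate σ hσ0 y).trans ?_
    have h1 : C / Real.sqrt (-σ) ≤ C / Real.sqrt (-t₁) :=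
      div_le_div_of_nonneg_left hC0 (Real.sqrt_pos.2 (neg_pos.2 ht₁0)) (Real.sqrt_le_sqrt (by linarith))
    linarith [h1]
  -- the step `h` with `2 C_os A² √(2h) ≤ δ`
  set h : ℝ := δ ^ 2 / (8 * (Cos * A ^ 2 + 1) ^ 2) with hh
  have hh0 : 0 < h := by positivity
  have hsq2h : Real.sqrt (2 * h) = δ / (2 * (Cos * A ^ 2 + 1)) := by
    rw [hh, show 2 * (δ ^ 2 / (8 * (Cos * A ^ 2 + 1) ^ 2)) = (δ / (2 * (Cos * A ^ 2 + 1))) ^ 2 by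
      field_simp; ring]
    exact Real.sqrt_sq (by positivity)
  have hstep : Cos * A ^ 2 * (2 * Real.sqrt (2 * h)) ≤ δ := by
    rw [hsq2h]
    have hpos : 0 < Cos * A ^ 2 + 1 := by positivity
    rw [show Cos * A ^ 2 * (2 * (δ / (2 * (Cos * A ^ 2 + 1)))) = δ * (Cos * A ^ 2 / (Cos * A ^ 2 + 1)) by
      field_simp]
    have hle : Cos * A ^ 2 / (Cos * A ^ 2 + 1) ≤ 1 := by
      rw [div_le_one hpos]; linarith
    calc δ * (Cos * A ^ 2 / (Cos * A ^ 2 + 1)) ≤ δ * 1 := mul_le_mul_of_nonneg_left hle hδ.le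
      _ = δ := mul_one δ
  -- ## the discrete bootstrap
  have hP : ∀ n : ℕ, ∀ τ ∈ Ioo t₀ t₁, τ < t₀ + n * h → ∀ y, ‖v τ y‖ ≤ 2 * δ := by
    intro n
    induction n with
    | zero =>
        intro τ hτ hlt
        simp only [Nat.cast_zero, zero_mul, add_zero] at hlt
        exact absurd hτ.1 (not_lt.2 hlt.le)
    | succ n ih =>
        -- crude bound `3δ` up to `t₀ + (n+1)h`
        have hcrude : ∀ τ ∈ Ioo t₀ t₁, τ < t₀ + (n + 1 : ℕ) * h → ∀ y, ‖v τ y‖ ≤ 3 * δ := by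
          intro τ hτ hlt y
          push_cast at hlt
          by_cases hτn : τ < t₀ + n * h
          · linarith [ih τ hτ hτn y, hδ]
          · push Not at hτn
            -- restart half a step back inside the controlled region (or at `t₀` itself)
            set s : ℝ := max t₀ (t₀ + n * h - h / 2) with hs
            have hst₀ : t₀ ≤ s := le_max_left _ _
            have hsτ : s < τ := by
              rw [hs, max_lt_iff]; exact ⟨hτ.1, by linarith⟩
            have hτs : τ - s ≤ 2 * h := by
              have : t₀ + n * h - h / 2 ≤ s := le_max_right _ _
              linarith
            have hτ0 : τ < 0 := hτ.2.trans ht₁0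
            -- the slice at `s` is bounded by `2δ`
            have hvs : ∀ z, ‖v s z‖ ≤ 2 * δ := by
              intro z
              by_cases hs0 : s = t₀
              · rw [hs0]; linarith [hsmall z, hδ]
              · have hs' : s = t₀ + n * h - h / 2 := by
                  rw [hs]
                  rcases le_total t₀ (t₀ + n * h - h / 2) with hle | hle
                  · exact max_eq_right hle
                  · exact absurd (max_eq_left hle) (by rw [← hs]; exact hs0)
                have hsgt : t₀ < s := lt_of_le_of_ne hst₀ (Ne.symm hs0)
                have hslt : s < t₀ + n * h := by rw [hs']; linarith
                exact ih s ⟨hsgt, hsτ.trans hτ.2⟩ hslt z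
            -- the mild identity from `s` to `τ`
            have hm := hmild s τ hsτ hτ0 y
            have hheat : ‖UnboundedOperators.heatExtension (v s) (τ - s) y‖ ≤ 2 * δ :=
              UnboundedOperators.norm_heatExtension_le hvs (by linarith) y
            have hMb : ∀ σ ∈ Ioo s τ, ∀ z, ‖v σ z‖ ≤ A := fun σ hσ z => hAbd σ (hσ.2.trans hτ.2) z
            have hduh := hDuh one_pos (s := s) (t := τ) hsτ hA0 hMb hMb y
            rw [hone, mul_one] at hduh
            have hduh' : ‖oseenDuhamel 1 s v v τ y‖ ≤ δ := by
              refine hduh.trans ((mul_le_mul_of_nonneg_left ?_ (by positivity)).trans hstep)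
              exact mul_le_mul_of_nonneg_left (Real.sqrt_le_sqrt (by linarith)) (by norm_num)
            rw [hm]
            linarith [(norm_sub_le _ _).trans (add_le_add hheat hduh')]
        -- sharp bound `2δ` from the identity started at `t₀`
        intro τ hτ hlt y
        have hτ0 : τ < 0 := hτ.2.trans ht₁0
        have hm := hmild t₀ τ hτ.1 hτ0 y
        have hheat : ‖UnboundedOperators.heatExtension (v t₀) (τ - t₀) y‖ ≤ δ :=
          UnboundedOperators.norm_heatExtension_le hsmall (by linarith [hτ.1]) y
        have h3δ : (0 : ℝ) ≤ 3 * δ := by positivity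
        have hMb : ∀ σ ∈ Ioo t₀ τ, ∀ z, ‖v σ z‖ ≤ 3 * δ := fun σ hσ z =>
          hcrude σ ⟨hσ.1, hσ.2.trans hτ.2⟩ (hσ.2.trans hlt) z
        have hduh := hDuh one_pos (s := t₀) (t := τ) hτ.1 h3δ hMb hMb y
        rw [hone, mul_one] at hduh
        -- `C_os (3δ)² 2√(τ − t₀) ≤ 18 C_os δ² √(−t₀) ≤ δ`
        have hsq : Real.sqrt (τ - t₀) ≤ Real.sqrt (-t₀) := Real.sqrt_le_sqrt (by linarith)
        have hduh' : ‖oseenDuhamel 1 t₀ v v τ y‖ ≤ δ := by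
          refine hduh.trans ?_
          calc Cos * (3 * δ) ^ 2 * (2 * Real.sqrt (τ - t₀)) ≤ Cos * (3 * δ) ^ 2 * (2 * Real.sqrt (-t₀)) := by
                gcongr
            _ = δ * (18 * Cos * δ * Real.sqrt (-t₀)) := by ring
            _ ≤ δ * 1 := mul_le_mul_of_nonneg_left h18 hδ.le
            _ = δ := mul_one δ
        rw [hm]
        linarith [(norm_sub_le _ _).trans (add_le_add hheat hduh')]
  -- ## reach `t⋆ < t₁` in finitely many steps
  obtain ⟨n, hn⟩ := exists_nat_gt ((t₁ - t₀) / h)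
  have hlt : tstar < t₀ + n * h := by
    have h1 : t₁ - t₀ < n * h := by rwa [div_lt_iff₀ hh0] at hn
    linarith
  exact hP n tstar ⟨htstar.1, hst₁⟩ hlt x

/-! ### a nontrivial profile is uniformly non-small at every far-past time -/

/-- **Frequently small ⇒ trivial.**  A profile with the Type-I rate and the Oseen identity that is small at SOME time
below every `T` — `∀ ε > 0 ∀ T ∃ t < T ∀ x, √(−t)‖v(t,x)‖ ≤ ε` — vanishes identically: forward smallness from those
slices makes `√(−t)‖v(t,x)‖ ≤ ε₀` on the whole slab, and K2-p2's backward ε-regularity `exists_eps_eq_zero_tail` (with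
`T = 0`) ends. -/
theorem eq_zero_of_frequently_small (hrate : HasTypeITimeDecay C v)
    (hmild : ∀ s t : ℝ, s < t → t < 0 → ∀ x,
      v t x = UnboundedOperators.heatExtension (v s) (t - s) x - oseenDuhamel 1 s v v t x)
    (hfreq : ∀ ε : ℝ, 0 < ε → ∀ T : ℝ, ∃ t < T, ∀ x, Real.sqrt (-t) * ‖v t x‖ ≤ ε) :
    ∀ t < 0, ∀ x, v t x = 0 := by
  obtain ⟨ε₀, hε₀, H⟩ := exists_eps_eq_zero_tail
  obtain ⟨κ, hκ, F⟩ := exists_kappa_forward_small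
  set ε : ℝ := min (ε₀ / 2) κ with hε
  have hε0 : 0 < ε := lt_min (by positivity) hκ
  have hεκ : ε ≤ κ := min_le_right _ _
  have hεε₀ : 2 * ε ≤ ε₀ := by have := min_le_left (ε₀ / 2) κ; linarith
  refine H le_rfl hmild fun τ hτ x => ?_
  -- a small slice below `τ`
  obtain ⟨t, htτ, ht⟩ := hfreq ε hε0 τ
  have ht0 : t < 0 := htτ.trans hτ
  have hst : 0 < Real.sqrt (-t) := Real.sqrt_pos.2 (neg_pos.2 ht0)
  have hsτ : 0 < Real.sqrt (-τ) := Real.sqrt_pos.2 (neg_pos.2 hτ)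
  set δ : ℝ := ε / Real.sqrt (-t) with hδ
  have hδ0 : 0 < δ := div_pos hε0 hst
  have hsmall : ∀ y, ‖v t y‖ ≤ δ := fun y => by
    rw [hδ, le_div_iff₀ hst, mul_comm]; exact ht y
  have hκ' : Real.sqrt (-t) * δ ≤ κ := by
    rw [hδ, mul_div_cancel₀ _ hst.ne']; exact hεκ
  have h2 := F hrate hmild ht0 hδ0 hsmall hκ' τ ⟨htτ, hτ⟩ x
  -- `√(−τ) · 2δ = 2ε √(−τ)/√(−t) ≤ 2ε ≤ ε₀`
  have hsq : Real.sqrt (-τ) ≤ Real.sqrt (-t) := Real.sqrt_le_sqrt (by linarith)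
  calc Real.sqrt (-τ) * ‖v τ x‖ ≤ Real.sqrt (-τ) * (2 * δ) := mul_le_mul_of_nonneg_left h2 hsτ.le
    _ ≤ Real.sqrt (-t) * (2 * δ) := mul_le_mul_of_nonneg_right hsq (by positivity)
    _ = 2 * ε := by rw [hδ]; field_simp
    _ ≤ ε₀ := hεε₀

/-- **A NONTRIVIAL PROFILE IS UNIFORMLY NON-SMALL AT EVERY FAR-PAST TIME.**  If a profile with the Type-I rate and
the Oseen identity does not vanish identically, there are `ε > 0` and `T < 0` such that EVERY slice `t < T` carries a
point `x` with `ε < √(−t)‖v(t,x)‖`. -/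
theorem exists_uniformly_nonsmall (hrate : HasTypeITimeDecay C v)
    (hmild : ∀ s t : ℝ, s < t → t < 0 → ∀ x,
      v t x = UnboundedOperators.heatExtension (v s) (t - s) x - oseenDuhamel 1 s v v t x)
    (hne : ∃ t < 0, ∃ x, v t x ≠ 0) :
    ∃ ε : ℝ, 0 < ε ∧ ∃ T : ℝ, T < 0 ∧ ∀ t < T, ∃ x, ε < Real.sqrt (-t) * ‖v t x‖ := by
  by_contra hcon
  push Not at hcon
  obtain ⟨t, ht, x, hx⟩ := hne
  refine hx (eq_zero_of_frequently_small hrate hmild (fun ε hε T => ?_) t ht x)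
  obtain ⟨t', ht', h⟩ := hcon ε hε (min T (-1)) (lt_of_le_of_lt (min_le_right _ _) (by norm_num))
  exact ⟨t', lt_of_lt_of_le ht' (min_le_left _ _), h⟩

end Summit.NavierStokesRegularity.NavierStokesRegularity.Theorems.PoloidalWindowDoorPoloidalWindowRigidityForwardSmallness

end
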